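import Mathlib
import Literature.NumberTheory.Transcendental.KZRulesAssociator
import Literature.NumberTheory.Transcendental.KZCalculusOver
import Summits.KontsevichZagierPeriods.KontsevichZagierPeriods.Theorems.SoloInformedProductOver
import Summits.KontsevichZagierPeriods.KontsevichZagierPeriods.Theorems.SoloInformedProductCommOver
import Summits.KontsevichZagierPeriods.KontsevichZagierPeriods.Theorems.SoloInformedPeriodRingOver
import Summits.KontsevichZagierPeriods.KontsevichZagierPeriods.Theorems.SoloInformedRealPeriodAlgebra
import Summits.KontsevichZagierPeriods.KontsevichZagierPeriods.Theorems.SoloInformedCoefficientInvariance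
import HarnessLib

/-!
# SoloInformed — the Literature period ring `KZ.FormalPeriodRing` IS `P_ℚ`, and sits in every `P_k`

Solo programme `solo-KontsevichZagierPeriods-informed`, session s240 (`paper/VERDICT.md` §1;
`paper/real-parameters.md`, (S2), naming item C903 (iii)).  The Literature library's formal period
ring `KZ.FormalPeriodRing = KZ.FormalRep ⧸ KZ.relations` (`KZRulesAssociator.lean`: product by
Fubini, `KZ.evalP : P →+* ℝ`) — the ring `P` of the residency verdict §§1–2, in which the summit reads
"`KZ.evalP` is injective" — and the coefficient-generic period ring
`SoloInformedPeriodRingOver k = KZOver.FormalRep k ⧸ KZOver.relations k` of the residency's `KZ_ℝ` and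
coefficient files (`SoloInformedPeriodRingOver`, `SoloInformedRealPeriodAlgebra`,
`SoloInformedCoefficientInvariance`) were so far linked only statement-wise
(`soloInformed_kzp_iff_injective_evalPOver_rat`).  This file packages the identification as RING
ISOMORPHISMS commuting with evaluation:

* `soloInformedPeriodRingEquivKZ : KZ.FormalPeriodRing ≃+* SoloInformedPeriodRingOver ℚ`, induced by
  the tautological `KZOver.equivKZ : KZ.FormalRep ≃+ KZOver.FormalRep ℚ` (which carries `KZ.relations`
  onto `KZOver.relations ℚ`, `KZOver.map_equivKZ_relations`, and is multiplicative,
  `soloInformed_equivKZ_mul`); `evalP`-compatible (`soloInformed_evalPOver_periodRingEquivKZ`), so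
  `Injective KZ.evalP ↔ Injective (soloInformedEvalPOver ℚ)`;
* composed with the coefficient isomorphism of `SoloInformedCoefficientInvariance`:
  `soloInformedPeriodRingEquivKZOver : KZ.FormalPeriodRing ≃+* SoloInformedPeriodRingOver k` for every
  coefficient ring `k → ℝ` with real-algebraic image (hypothesis-free at `k = integralClosure ℚ ℝ`),
  again `evalP`-compatible — so `Injective KZ.evalP ↔ Injective (soloInformedEvalPOver k)`;
* composed with base change `ℚ → ℝ`: the ring map
  `soloInformedPeriodRingKZToReal : KZ.FormalPeriodRing →+* SoloInformedPeriodRingOver ℝ`,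
  `⟦[r]⟧ ↦ ⟦[r]_ℝ⟧`, `evalP`-compatible, sending `⟦[D̄, 1]⟧` to `soloInformedPiClassReal`, and
  INJECTIVE granting the Lion–Rolin preparation fact (THEOREM T of `paper/real-parameters.md`, through
  `soloInformed_periodRingBaseChange_rat_real_injective_prep`) — the verdict's clause "`P ↪ P_ℝ`" with
  `P` literally the Literature ring.

Statement hygiene only (the verdict's `P`, `P_ℚ`, `P_k`, and the source of `P → P_ℝ` are one ring up to
canonical isomorphism); nothing here bears on Conjecture 1 itself.  The equivalence
`KontsevichZagierPeriods ↔ Injective KZ.evalP` is `soloInformed_kzp_iff_injective_evalP`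
(`SoloInformedLocSplit`) and is not restated.
References: M. Kontsevich, D. Zagier, *Periods* (2001), §1.2, §4.1.
-/

noncomputable section

namespace Summit.KontsevichZagierPeriods.KontsevichZagierPeriods.Theorems

open Set Literature.ModelTheory.ExponentialFields Literature.NumberTheory.Transcendental

/-! ### `KZOver.equivKZ` respects units, products (inverse direction) and relations -/

/-- The unit representation `[pt, 1]` of `KZRulesAssociator` is, read over `ℚ`, the unit
representation `soloInformedUnitOver` (same domain `univ`, same integrand `1`). -/
theorem soloInformed_ofKZ_unit :
    KZOver.IntegralRep.ofKZ KZ.IntegralRep.unit = soloInformedUnitOver (k := ℚ) :=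
  KZOver.IntegralRep.ext rfl rfl

/-- `equivKZ [pt, 1] = [pt, 1]`. -/
theorem soloInformed_equivKZ_of_unit :
    KZOver.equivKZ (KZ.of KZ.IntegralRep.unit) = KZOver.of (soloInformedUnitOver (k := ℚ)) := by
  rw [KZOver.equivKZ_of, soloInformed_ofKZ_unit]

/-- The inverse `equivKZ.symm : KZOver.FormalRep ℚ → KZ.FormalRep` is multiplicative (from
`soloInformed_equivKZ_mul`). -/
theorem soloInformed_equivKZ_symm_mul (c c' : KZOver.FormalRep ℚ) :
    KZOver.equivKZ.symm (c * c') = KZOver.equivKZ.symm c * KZOver.equivKZ.symm c' := by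
  apply KZOver.equivKZ.injective
  rw [soloInformed_equivKZ_mul, AddEquiv.apply_symm_apply, AddEquiv.apply_symm_apply,
    AddEquiv.apply_symm_apply]

/-- `equivKZ.symm c` is a KZ relation iff `c` is a relation over `ℚ`. -/
theorem soloInformed_equivKZ_symm_mem_relations_iff (c : KZOver.FormalRep ℚ) :
    KZOver.equivKZ.symm c ∈ KZ.relations ↔ c ∈ KZOver.relations ℚ := by
  rw [← KZOver.equivKZ_mem_relations_iff, AddEquiv.apply_symm_apply]

/-! ### The two ring homomorphisms -/

/-- **`KZ.FormalPeriodRing →+* P_ℚ`**, `⟦c⟧ ↦ ⟦equivKZ c⟧`: well defined because `equivKZ` maps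
`KZ.relations` into `KZOver.relations ℚ`, unital by `soloInformed_equivKZ_of_unit`, multiplicative by
`soloInformed_equivKZ_mul`. [Kontsevich–Zagier 2001, §4.1] -/
def soloInformedPeriodRingOfKZ : KZ.FormalPeriodRing →+* SoloInformedPeriodRingOver ℚ where
  toFun := Quotient.lift (fun c : KZ.FormalRep => soloInformedToPeriodOver ℚ (KZOver.equivKZ c))
    fun a b (h : KZ.ringCon a b) => by
      rw [KZ.ringCon_apply] at h
      rw [soloInformed_toPeriodOver_eq_iff, ← map_sub]
      exact (KZOver.equivKZ_mem_relations_iff _).mpr h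
  map_one' := by
    change soloInformedToPeriodOver ℚ (KZOver.equivKZ (KZ.of KZ.IntegralRep.unit)) = 1
    rw [soloInformed_equivKZ_of_unit, soloInformed_toPeriodOver_of_unitOver]
  map_mul' x y := by
    induction x using Quotient.inductionOn' with | h c => ?_
    induction y using Quotient.inductionOn' with | h d => ?_
    change soloInformedToPeriodOver ℚ (KZOver.equivKZ (c * d)) =
      soloInformedToPeriodOver ℚ (KZOver.equivKZ c) * soloInformedToPeriodOver ℚ (KZOver.equivKZ d)
    rw [soloInformed_equivKZ_mul, map_mul]
  map_zero' := by
    change soloInformedToPeriodOver ℚ (KZOver.equivKZ 0) = 0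
    rw [map_zero, map_zero]
  map_add' x y := by
    induction x using Quotient.inductionOn' with | h c => ?_
    induction y using Quotient.inductionOn' with | h d => ?_
    change soloInformedToPeriodOver ℚ (KZOver.equivKZ (c + d)) =
      soloInformedToPeriodOver ℚ (KZOver.equivKZ c) + soloInformedToPeriodOver ℚ (KZOver.equivKZ d)
    rw [map_add, map_add]

/-- `soloInformedPeriodRingOfKZ ⟦c⟧ = ⟦equivKZ c⟧`. -/
@[simp] theorem soloInformed_periodRingOfKZ_toFormalPeriod (c : KZ.FormalRep) :
    soloInformedPeriodRingOfKZ (KZ.toFormalPeriod c) =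
      soloInformedToPeriodOver ℚ (KZOver.equivKZ c) := rfl

/-- **`P_ℚ →+* KZ.FormalPeriodRing`**, `⟦c⟧ ↦ ⟦equivKZ.symm c⟧`: well defined by
`soloInformed_equivKZ_symm_mem_relations_iff`, unital, multiplicative by
`soloInformed_equivKZ_symm_mul`. [Kontsevich–Zagier 2001, §4.1] -/
def soloInformedPeriodRingToKZ : SoloInformedPeriodRingOver ℚ →+* KZ.FormalPeriodRing where
  toFun := Quotient.lift (fun c : KZOver.FormalRep ℚ => KZ.toFormalPeriod (KZOver.equivKZ.symm c))
    fun a b (h : soloInformedRingConOver ℚ a b) => by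
      rw [soloInformed_ringConOver_apply] at h
      rw [KZ.toFormalPeriod_eq_iff, ← map_sub]
      exact (soloInformed_equivKZ_symm_mem_relations_iff _).mpr h
  map_one' := by
    change KZ.toFormalPeriod (KZOver.equivKZ.symm (KZOver.of (soloInformedUnitOver (k := ℚ)))) = 1
    rw [← soloInformed_equivKZ_of_unit, AddEquiv.symm_apply_apply, KZ.toFormalPeriod_of_unit]
  map_mul' x y := by
    induction x using Quotient.inductionOn' with | h c => ?_
    induction y using Quotient.inductionOn' with | h d => ?_
    change KZ.toFormalPeriod (KZOver.equivKZ.symm (c * d)) =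
      KZ.toFormalPeriod (KZOver.equivKZ.symm c) * KZ.toFormalPeriod (KZOver.equivKZ.symm d)
    rw [soloInformed_equivKZ_symm_mul, map_mul]
  map_zero' := by
    change KZ.toFormalPeriod (KZOver.equivKZ.symm 0) = 0
    rw [map_zero, map_zero]
  map_add' x y := by
    induction x using Quotient.inductionOn' with | h c => ?_
    induction y using Quotient.inductionOn' with | h d => ?_
    change KZ.toFormalPeriod (KZOver.equivKZ.symm (c + d)) =
      KZ.toFormalPeriod (KZOver.equivKZ.symm c) + KZ.toFormalPeriod (KZOver.equivKZ.symm d)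
    rw [map_add, map_add]

/-- `soloInformedPeriodRingToKZ ⟦c⟧ = ⟦equivKZ.symm c⟧`. -/
@[simp] theorem soloInformed_periodRingToKZ_toPeriodOver (c : KZOver.FormalRep ℚ) :
    soloInformedPeriodRingToKZ (soloInformedToPeriodOver ℚ c) =
      KZ.toFormalPeriod (KZOver.equivKZ.symm c) := rfl

/-- The two ring maps are mutually inverse (first round trip). -/
theorem soloInformed_periodRingToKZ_ofKZ (x : KZ.FormalPeriodRing) :
    soloInformedPeriodRingToKZ (soloInformedPeriodRingOfKZ x) = x := by
  obtain ⟨c, rfl⟩ := KZ.toFormalPeriod_surjective x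
  rw [soloInformed_periodRingOfKZ_toFormalPeriod, soloInformed_periodRingToKZ_toPeriodOver,
    AddEquiv.symm_apply_apply]

/-- The two ring maps are mutually inverse (second round trip). -/
theorem soloInformed_periodRingOfKZ_toKZ (y : SoloInformedPeriodRingOver ℚ) :
    soloInformedPeriodRingOfKZ (soloInformedPeriodRingToKZ y) = y := by
  obtain ⟨c, rfl⟩ := soloInformed_toPeriodOver_surjective ℚ y
  rw [soloInformed_periodRingToKZ_toPeriodOver, soloInformed_periodRingOfKZ_toFormalPeriod,
    AddEquiv.apply_symm_apply]

/-! ### The ring isomorphism `KZ.FormalPeriodRing ≃+* P_ℚ` -/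

/-- **`KZ.FormalPeriodRing ≃+* SoloInformedPeriodRingOver ℚ`**: the Literature library's formal
period ring `P = KZ.FormalRep ⧸ KZ.relations` IS the coefficient-`ℚ` period ring of the residency's
`KZOver` files, as a ring — the isomorphism `⟦c⟧ ↦ ⟦equivKZ c⟧` induced by the tautological
identification `KZOver.equivKZ` of the two calculi (`paper/real-parameters.md`, (S2)).
[Kontsevich–Zagier 2001, §1.2, §4.1] -/
def soloInformedPeriodRingEquivKZ : KZ.FormalPeriodRing ≃+* SoloInformedPeriodRingOver ℚ where
  toFun := soloInformedPeriodRingOfKZ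
  invFun := soloInformedPeriodRingToKZ
  left_inv := soloInformed_periodRingToKZ_ofKZ
  right_inv := soloInformed_periodRingOfKZ_toKZ
  map_mul' := map_mul soloInformedPeriodRingOfKZ
  map_add' := map_add soloInformedPeriodRingOfKZ

/-- `soloInformedPeriodRingEquivKZ ⟦c⟧ = ⟦equivKZ c⟧`. -/
@[simp] theorem soloInformed_periodRingEquivKZ_toFormalPeriod (c : KZ.FormalRep) :
    soloInformedPeriodRingEquivKZ (KZ.toFormalPeriod c) =
      soloInformedToPeriodOver ℚ (KZOver.equivKZ c) := rfl

/-- `soloInformedPeriodRingEquivKZ.symm ⟦c⟧ = ⟦equivKZ.symm c⟧`. -/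
@[simp] theorem soloInformed_periodRingEquivKZ_symm_toPeriodOver (c : KZOver.FormalRep ℚ) :
    soloInformedPeriodRingEquivKZ.symm (soloInformedToPeriodOver ℚ c) =
      KZ.toFormalPeriod (KZOver.equivKZ.symm c) := rfl

/-- On the class of a representation: `⟦[r]⟧ ↦ ⟦[ofKZ r]⟧`. -/
theorem soloInformed_periodRingEquivKZ_toFormalPeriod_of {n : ℕ} (r : KZ.IntegralRep n) :
    soloInformedPeriodRingEquivKZ (KZ.toFormalPeriod (KZ.of r)) =
      soloInformedToPeriodOver ℚ (KZOver.of (KZOver.IntegralRep.ofKZ r)) := by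
  rw [soloInformed_periodRingEquivKZ_toFormalPeriod, KZOver.equivKZ_of]

/-- **The isomorphism commutes with evaluation**: `evalP_ℚ (E x) = KZ.evalP x`.
[Kontsevich–Zagier 2001, §4.1] -/
@[simp] theorem soloInformed_evalPOver_periodRingEquivKZ (x : KZ.FormalPeriodRing) :
    soloInformedEvalPOver ℚ (soloInformedPeriodRingEquivKZ x) = KZ.evalP x := by
  obtain ⟨c, rfl⟩ := KZ.toFormalPeriod_surjective x
  rw [soloInformed_periodRingEquivKZ_toFormalPeriod, soloInformed_evalPOver_toPeriodOver,
    KZOver.eval_equivKZ, KZ.evalP_toFormalPeriod]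

/-- The inverse isomorphism commutes with evaluation: `KZ.evalP (E.symm y) = evalP_ℚ y`.
[Kontsevich–Zagier 2001, §4.1] -/
@[simp] theorem soloInformed_evalP_periodRingEquivKZ_symm (y : SoloInformedPeriodRingOver ℚ) :
    KZ.evalP (soloInformedPeriodRingEquivKZ.symm y) = soloInformedEvalPOver ℚ y := by
  rw [← soloInformed_evalPOver_periodRingEquivKZ (soloInformedPeriodRingEquivKZ.symm y),
    RingEquiv.apply_symm_apply]

/-- As ring homomorphisms: `evalP_ℚ ∘ E = KZ.evalP`. -/
theorem soloInformed_evalPOver_comp_periodRingEquivKZ :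
    (soloInformedEvalPOver ℚ).comp soloInformedPeriodRingEquivKZ.toRingHom = KZ.evalP :=
  RingHom.ext soloInformed_evalPOver_periodRingEquivKZ

/-- **Injectivity of evaluation is the same statement on both rings**:
`KZ.evalP : KZ.FormalPeriodRing → ℝ` is injective iff `soloInformedEvalPOver ℚ : P_ℚ → ℝ` is.
(With `soloInformed_kzp_iff_injective_evalP`, resp. `soloInformed_kzp_iff_injective_evalPOver_rat`,
both are the summit `KontsevichZagierPeriods`.) [Kontsevich–Zagier 2001, §1.2, Conjecture 1] -/
theorem soloInformed_injective_evalP_iff_injective_evalPOver_rat :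
    Function.Injective KZ.evalP ↔ Function.Injective (soloInformedEvalPOver ℚ) := by
  constructor
  · intro h x y hxy
    apply soloInformedPeriodRingEquivKZ.symm.injective
    apply h
    rwa [soloInformed_evalP_periodRingEquivKZ_symm, soloInformed_evalP_periodRingEquivKZ_symm]
  · intro h x y hxy
    apply soloInformedPeriodRingEquivKZ.injective
    apply h
    rwa [soloInformed_evalPOver_periodRingEquivKZ, soloInformed_evalPOver_periodRingEquivKZ]

/-- Kernel form: `KZ.evalP x = 0 ↔ evalP_ℚ (E x) = 0`, i.e. the isomorphism identifies the two
evaluation kernels. -/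
theorem soloInformed_evalP_eq_zero_iff_periodRingEquivKZ (x : KZ.FormalPeriodRing) :
    KZ.evalP x = 0 ↔ soloInformedEvalPOver ℚ (soloInformedPeriodRingEquivKZ x) = 0 := by
  rw [soloInformed_evalPOver_periodRingEquivKZ]

/-! ### `KZ.FormalPeriodRing ≃+* P_k` for every real-algebraic coefficient ring `k` -/

section Algebraic

variable {k : Type*} [CommRing k] [Algebra k ℝ] [Algebra ℚ k] [IsScalarTower ℚ k ℝ]
  (halg : ∀ a : k, IsAlgebraic ℚ (algebraMap k ℝ a))

include halg

/-- **`KZ.FormalPeriodRing ≃+* SoloInformedPeriodRingOver k`** for every coefficient ring `k → ℝ`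
with real-algebraic image: the Literature period ring is the period ring of the calculus with
`k`-semialgebraic data and `k`-moves (`soloInformedPeriodRingEquivKZ` followed by the coefficient
isomorphism `soloInformedPeriodRingCoeffEquiv` of `SoloInformedCoefficientInvariance`).
[Kontsevich–Zagier 2001, §§1.1–1.2, §4.1] -/
def soloInformedPeriodRingEquivKZOver : KZ.FormalPeriodRing ≃+* SoloInformedPeriodRingOver k :=
  soloInformedPeriodRingEquivKZ.trans (soloInformedPeriodRingCoeffEquiv halg)

/-- `soloInformedPeriodRingEquivKZOver ⟦c⟧ = ⟦baseChange ℚ k (equivKZ c)⟧`. -/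
theorem soloInformed_periodRingEquivKZOver_toFormalPeriod (c : KZ.FormalRep) :
    soloInformedPeriodRingEquivKZOver halg (KZ.toFormalPeriod c) =
      soloInformedToPeriodOver k (KZOver.baseChange ℚ k (KZOver.equivKZ c)) := by
  change soloInformedPeriodRingCoeffEquiv halg (soloInformedPeriodRingEquivKZ (KZ.toFormalPeriod c)) = _
  rw [soloInformed_periodRingEquivKZ_toFormalPeriod]
  exact soloInformed_periodRingBaseChange_toPeriodOver (KZOver.equivKZ c)

/-- On the class of a representation: `⟦[r]⟧ ↦ ⟦[ofKZOver k r]⟧` (the same domain and integrand,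
read with coefficients in `k`). -/
theorem soloInformed_periodRingEquivKZOver_toFormalPeriod_of {n : ℕ} (r : KZ.IntegralRep n) :
    soloInformedPeriodRingEquivKZOver halg (KZ.toFormalPeriod (KZ.of r)) =
      soloInformedToPeriodOver k (KZOver.of (KZOver.IntegralRep.ofKZOver k r)) := by
  rw [soloInformed_periodRingEquivKZOver_toFormalPeriod, KZOver.equivKZ_of, KZOver.baseChange_of]

/-- **The isomorphism `KZ.FormalPeriodRing ≃+* P_k` commutes with evaluation.**
[Kontsevich–Zagier 2001, §4.1] -/
@[simp] theorem soloInformed_evalPOver_periodRingEquivKZOver (x : KZ.FormalPeriodRing) :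
    soloInformedEvalPOver k (soloInformedPeriodRingEquivKZOver halg x) = KZ.evalP x := by
  change soloInformedEvalPOver k
      (soloInformedPeriodRingCoeffEquiv halg (soloInformedPeriodRingEquivKZ x)) = _
  rw [soloInformed_evalPOver_periodRingCoeffEquiv, soloInformed_evalPOver_periodRingEquivKZ]

/-- **Injectivity of evaluation is coefficient-invariant, anchored at the Literature ring**:
`KZ.evalP` is injective iff `soloInformedEvalPOver k : P_k → ℝ` is, for every real-algebraic `k`.
[Kontsevich–Zagier 2001, §§1.1–1.2, Conjecture 1] -/
theorem soloInformed_injective_evalP_iff_injective_evalPOver_of_isAlgebraic :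
    Function.Injective KZ.evalP ↔ Function.Injective (soloInformedEvalPOver k) :=
  soloInformed_injective_evalP_iff_injective_evalPOver_rat.trans
    (soloInformed_injective_evalPOver_iff_of_isAlgebraic halg).symm

end Algebraic

/-- Hypothesis-free instance: **`KZ.FormalPeriodRing ≃+* P_{ℝ ∩ ℚ̄}`**, the period ring of the
calculus with real-algebraic coefficients (`k = integralClosure ℚ ℝ`).
[Kontsevich–Zagier 2001, §§1.1–1.2, §4.1] -/
def soloInformedPeriodRingEquivKZRealAlgebraic :
    KZ.FormalPeriodRing ≃+* SoloInformedPeriodRingOver (integralClosure ℚ ℝ) :=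
  soloInformedPeriodRingEquivKZOver soloInformed_isAlgebraic_of_integralClosure

/-- The hypothesis-free instance commutes with evaluation. -/
@[simp] theorem soloInformed_evalPOver_periodRingEquivKZRealAlgebraic (x : KZ.FormalPeriodRing) :
    soloInformedEvalPOver (integralClosure ℚ ℝ) (soloInformedPeriodRingEquivKZRealAlgebraic x) =
      KZ.evalP x :=
  soloInformed_evalPOver_periodRingEquivKZOver _ x

/-- `KZ.evalP` is injective iff evaluation on the real-algebraic-coefficient period ring is
(hypothesis-free). [Kontsevich–Zagier 2001, §§1.1–1.2, Conjecture 1] -/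
theorem soloInformed_injective_evalP_iff_injective_evalPOver_realAlgebraic :
    Function.Injective KZ.evalP ↔
      Function.Injective (soloInformedEvalPOver (integralClosure ℚ ℝ)) :=
  soloInformed_injective_evalP_iff_injective_evalPOver_of_isAlgebraic
    soloInformed_isAlgebraic_of_integralClosure

/-! ### The ring map `KZ.FormalPeriodRing →+* P_ℝ` -/

/-- **`KZ.FormalPeriodRing →+* SoloInformedPeriodRingOver ℝ`**, `⟦[r]⟧ ↦ ⟦[r]_ℝ⟧`: the Literature
period ring mapped into the period ring of the real-coefficient calculus `KZ_ℝ` (the isomorphism onto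
`P_ℚ` followed by base change `ℚ → ℝ`).  Not surjective in any useful sense and NOT an isomorphism onto
its essential image of relations (THEOREM R of `paper/real-parameters.md`); injective granting
preparation (`soloInformed_periodRingKZToReal_injective_prep`). [Kontsevich–Zagier 2001, §1.2, §4.1] -/
def soloInformedPeriodRingKZToReal : KZ.FormalPeriodRing →+* SoloInformedPeriodRingOver ℝ :=
  (soloInformedPeriodRingBaseChange ℚ ℝ).comp soloInformedPeriodRingEquivKZ.toRingHom

/-- `soloInformedPeriodRingKZToReal ⟦c⟧ = ⟦baseChange ℚ ℝ (equivKZ c)⟧`. -/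
theorem soloInformed_periodRingKZToReal_toFormalPeriod (c : KZ.FormalRep) :
    soloInformedPeriodRingKZToReal (KZ.toFormalPeriod c) =
      soloInformedToPeriodOver ℝ (KZOver.baseChange ℚ ℝ (KZOver.equivKZ c)) := rfl

/-- On the class of a representation: `⟦[r]⟧ ↦ ⟦[ofKZOver ℝ r]⟧`. -/
theorem soloInformed_periodRingKZToReal_toFormalPeriod_of {n : ℕ} (r : KZ.IntegralRep n) :
    soloInformedPeriodRingKZToReal (KZ.toFormalPeriod (KZ.of r)) =
      soloInformedToPeriodOver ℝ (KZOver.of (KZOver.IntegralRep.ofKZOver ℝ r)) := by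
  rw [soloInformed_periodRingKZToReal_toFormalPeriod, KZOver.equivKZ_of, KZOver.baseChange_of]

/-- **`⟦[D̄, 1]⟧ ↦ ⟦π⟧_ℝ`**: the class of KZ's disc representation goes to `soloInformedPiClassReal`,
the element whose non-zero-divisor property is Question `Q_ℝ` (`SoloInformedPiCancellationReal`,
`soloInformed_piCancellationReal_iff_mem_nonZeroDivisors`). -/
theorem soloInformed_periodRingKZToReal_pi :
    soloInformedPeriodRingKZToReal (KZ.toFormalPeriod (KZ.of KZ.piRep)) = soloInformedPiClassReal :=
  soloInformed_periodRingKZToReal_toFormalPeriod_of KZ.piRep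

/-- **The map `KZ.FormalPeriodRing → P_ℝ` commutes with evaluation.** [Kontsevich–Zagier 2001, §4.1] -/
@[simp] theorem soloInformed_evalPOver_periodRingKZToReal (x : KZ.FormalPeriodRing) :
    soloInformedEvalPOver ℝ (soloInformedPeriodRingKZToReal x) = KZ.evalP x := by
  change soloInformedEvalPOver ℝ
      (soloInformedPeriodRingBaseChange ℚ ℝ (soloInformedPeriodRingEquivKZ x)) = _
  rw [soloInformed_evalPOver_baseChange, soloInformed_evalPOver_periodRingEquivKZ]

/-- **`KZ.FormalPeriodRing ↪ P_ℝ` granting preparation** (THEOREM T of the residency, module form,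
with the Literature ring as source): two formal `ℤ`-combinations of KZ representations that differ
by REAL-coefficient moves already differ by `ℚ`-coefficient moves. Conditional on the Lion–Rolin /
Kaiser preparation fact `semialgebraicPreparation`. [Kontsevich–Zagier 2001, §1.2] -/
theorem soloInformed_periodRingKZToReal_injective_prep (hprep : semialgebraicPreparation) :
    Function.Injective soloInformedPeriodRingKZToReal :=
  (soloInformed_periodRingBaseChange_rat_real_injective_prep hprep).comp
    soloInformedPeriodRingEquivKZ.injective

/-- Relation form of the same theorem: for KZ formal combinations `c`, `d`, the real-coefficient
classes `⟦c⟧_ℝ = ⟦d⟧_ℝ` agree iff `c − d ∈ KZ.relations` (granting preparation). -/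
theorem soloInformed_periodRingKZToReal_toFormalPeriod_eq_iff_prep (hprep : semialgebraicPreparation)
    (c d : KZ.FormalRep) :
    soloInformedPeriodRingKZToReal (KZ.toFormalPeriod c) =
        soloInformedPeriodRingKZToReal (KZ.toFormalPeriod d) ↔ c - d ∈ KZ.relations := by
  rw [(soloInformed_periodRingKZToReal_injective_prep hprep).eq_iff, KZ.toFormalPeriod_eq_iff]

end Summit.KontsevichZagierPeriods.KontsevichZagierPeriods.Theorems
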